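import Summits.QuantumFields.YangMills.Theorems.LuscherReductionTwistedTraceScalingBOAssemblyBricks
import Summits.QuantumFields.YangMills.Theorems.LuscherReductionTwistedTraceScalingFPWeightCore
import HarnessLib

/-!
# The fibre-mass brick (B-N) from the Faddeev–Popov constancy (P): `fibreMass (N/χ) Ω u ≡ γ(1 ± κ)` on the slow window
# (lane A of S-BASE, crux `TwistedTraceScaling` stmt-QuantumFields-20203, C4 INNER; design note `pub/ym-fleet/ym-luscher-20007-p1/COARSE-DESIGN.md` §24.7 (B-N))

For a weight of the record shape `χ = 𝟙_F · exp(−gaugeCoordSq/δg²)` (`recordWeightRho`: `F` = the fat tube) and a fibre profile `Ω` whose fibres `orthoTube u v`, `v ∈ supp Ω`, lie in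
`F`, the fibre mass `∫ Ω(v)²·(N/χ)(orthoTube u v) dπ(v)` equals `∫ Ω² e^{+‖P_Γ v‖²/δg²}·N(orthoTube u v) dπ` (the Gaussian factor is a function of `relLinkVec (orthoTube u v) = v`
alone, `relLinkVec_orthoTube`), hence lies in `γ·[1−κ, 1+κ]` as soon as `N ∈ N̄[1−κ, 1+κ]` on `F` — which is (P) `fpWeight_core_constant[_pow]` (p641793) with `κ = Cδ²`.
* `boGamma` — the constant `γ = N̄·∫ Ω(v)² e^{‖P_Γ v‖²/δg²} dπ(v)`;
* ★★ `fibreMass_brick` — `|fibreMass (softWeight χ) Ω u − γ| ≤ κγ` (fixed `β`, abstract `F`, `N̄`, `κ`);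
* ★★ `fibreMass_brick_record` — the same for `χ = recordWeightRho δ ρ δg β` with the (P) sandwich as hypothesis.
HONEST FRAMING: one brick ((B-N), the cheapest) of the typed list `BOBricks`; (B-T)/(B-ST)/(B-OD) OPEN; C4 OPEN; not a gap, not Clay.
-/

set_option autoImplicit false

noncomputable section

open MeasureTheory Filter Topology Real
open scoped BigOperators
open Literature.MathematicalPhysics.QuantumFieldTheory
open Literature.MathematicalPhysics.QuantumLattice

namespace Summit.QuantumFields.YangMills.Theorems.FemtoTransferGap.TwoLattice.ConstTube

open Summit.QuantumFields.YangMills.Theorems.FemtoTransferGap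
open Summit.QuantumFields.YangMills.Theorems.FemtoTransferGap.TwoLattice.Avg
open Summit.QuantumFields.YangMills.Theorems.FemtoTransferGap.TwoLattice.Stiff (LinkSpace)

variable (L : ℕ) [NeZero L]

/-! ## §1 The constant `γ` -/

/-- The BO fibre-mass constant `γ = N̄ · ∫ Ω(v)² · e^{‖P_Γ v‖²/δg²} dπ(v)`. [folklore] -/
def boGamma (Ω : LinkSpace L → ℝ) (δg Nbar : ℝ) : ℝ :=
  Nbar * ∫ v, Ω (linkEmbed L v) ^ 2 * Real.exp (‖(gaugeModes L).starProjection (linkEmbed L v)‖ ^ 2 / δg ^ 2) ∂orthoTransverse L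

variable {L}

/-- The Gaussian factor of the record weight on a fibre point is a function of the transverse variable alone. [folklore] -/
theorem gaugeCoordSq_orthoTube (u : GaugeConfig 3 1 SU2) {v : Edge 3 L → Fin 3 → ℝ} (hv : v ∈ capBalancedSet L) :
    gaugeCoordSq L (orthoTube L u v) = ‖(gaugeModes L).starProjection (linkEmbed L v)‖ ^ 2 := by
  unfold gaugeCoordSq; rw [relLinkVec_orthoTube L u hv]

/-! ## §2 ★★ The brick for a weight of record shape -/

/-- ★★ **FIBRE-MASS BRICK (B-N), abstract form.**  `χ = 𝟙_F·e^{−gaugeCoordSq/δg²}`, `N = gaugeAvg χ ∈ N̄[1−κ,1+κ]` on `F` (no sign conditions needed), `Ω` bounded measurable with norm-bounded support, and every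
fibre point `orthoTube u v` with `v ∈ supp Ω` (on the cap) in `F` ⇒ `|fibreMass (N/χ) Ω u − γ| ≤ κγ`. [cite: Luscher1983, §3] -/
theorem fibreMass_brick {F : Set (GaugeConfig 3 L SU2)} {δg : ℝ} {χ : GaugeConfig 3 L SU2 → ℝ}
    (hχ : ∀ U, χ U = F.indicator (fun _ => (1 : ℝ)) U * Real.exp (-(gaugeCoordSq L U / δg ^ 2))) (hχm : Measurable χ)
    {Nbar κ : ℝ}
    (hN : ∀ U ∈ F, Nbar * (1 - κ) ≤ gaugeAvg χ U ∧ gaugeAvg χ U ≤ Nbar * (1 + κ))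
    {Ω : LinkSpace L → ℝ} (hΩ : Measurable Ω) {CΩ : ℝ} (hCΩ : ∀ x, |Ω x| ≤ CΩ) {R : ℝ} (hΩR : ∀ x, Ω x ≠ 0 → ‖x‖ ≤ R)
    {u : GaugeConfig 3 1 SU2} (hu : ∀ v ∈ capBalancedSet L, Ω (linkEmbed L v) ≠ 0 → orthoTube L u v ∈ F) :
    |fibreMass L (softWeight χ) Ω u - boGamma L Ω δg Nbar| ≤ κ * boGamma L Ω δg Nbar := by
  haveI := isFiniteMeasure_orthoTransverse L
  have hae : ∀ᵐ v ∂orthoTransverse L, v ∈ capBalancedSet L := by rw [ae_iff]; exact orthoTransverse_compl_capBalancedSet L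
  -- the `u`-free integrand `h(v) = Ω(v)² e^{‖P v‖²/δg²}` and the pointwise identity on the cap
  set h : (Edge 3 L → Fin 3 → ℝ) → ℝ := fun v => Ω (linkEmbed L v) ^ 2 * Real.exp (‖(gaugeModes L).starProjection (linkEmbed L v)‖ ^ 2 / δg ^ 2) with hh
  have hpt : ∀ v ∈ capBalancedSet L, Ω (linkEmbed L v) ^ 2 * softWeight χ (orthoTube L u v) = h v * gaugeAvg χ (orthoTube L u v) := by
    intro v hv
    by_cases hΩ0 : Ω (linkEmbed L v) = 0
    · simp only [hh, hΩ0]; ring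
    · have hF := hu v hv hΩ0
      unfold softWeight
      rw [hχ (orthoTube L u v), Set.indicator_of_mem hF, one_mul, gaugeCoordSq_orthoTube u hv, hh]
      have hex : Real.exp (-(‖(gaugeModes L).starProjection (linkEmbed L v)‖ ^ 2 / δg ^ 2)) ≠ 0 := (Real.exp_pos _).ne'
      field_simp
      rw [mul_assoc, ← Real.exp_add, neg_add_cancel, Real.exp_zero, mul_one]
  -- bounds on `h`: `0 ≤ h ≤ CΩ² e^{R²/δg²}`
  have hCΩ0 : 0 ≤ CΩ := (abs_nonneg _).trans (hCΩ 0)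
  have hh0 : ∀ v, 0 ≤ h v := fun v => by simp only [hh]; positivity
  have hhb : ∀ v, h v ≤ CΩ ^ 2 * Real.exp (R ^ 2 / δg ^ 2) := fun v => by
    simp only [hh]
    by_cases hΩ0 : Ω (linkEmbed L v) = 0
    · rw [hΩ0]; simp only [ne_eq, OfNat.ofNat_ne_zero, not_false_eq_true, zero_pow, zero_mul]; positivity
    · have hxR := hΩR _ hΩ0
      have hP : ‖(gaugeModes L).starProjection (linkEmbed L v)‖ ≤ R :=
        (Submodule.norm_starProjection_apply_le (gaugeModes L) (linkEmbed L v)).trans hxR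
      have hR0 : 0 ≤ R := (norm_nonneg _).trans hxR
      refine mul_le_mul (by rw [← sq_abs]; exact pow_le_pow_left₀ (abs_nonneg _) (hCΩ _) 2) (Real.exp_le_exp.mpr ?_) (Real.exp_pos _).le (by positivity)
      exact div_le_div_of_nonneg_right (pow_le_pow_left₀ (norm_nonneg _) hP 2) (sq_nonneg _)
  have hhm : Measurable h := by
    simp only [hh]
    exact ((hΩ.comp (measurable_linkEmbed L)).pow_const 2).mul
      ((((gaugeModes L).starProjection.continuous.measurable.comp (measurable_linkEmbed L)).norm.pow_const 2).div_const _ |>.exp)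
  -- `N` along the fibre: measurable and bounded by `1`
  have hχb : ∀ U, |χ U| ≤ 1 := fun U => by
    rw [hχ U]
    have h1 : (F.indicator (fun _ => (1 : ℝ)) U) ∈ Set.Icc (0 : ℝ) 1 := ⟨Set.indicator_nonneg (fun _ _ => zero_le_one) U, Set.indicator_le_self' (fun _ _ => zero_le_one) U⟩
    have h2 : Real.exp (-(gaugeCoordSq L U / δg ^ 2)) ≤ 1 := Real.exp_le_one_iff.mpr (by
      have h0 := gaugeCoordSq_nonneg L U; have : 0 ≤ gaugeCoordSq L U / δg ^ 2 := div_nonneg h0 (sq_nonneg _); linarith)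
    rw [abs_le]; constructor
    · have := mul_nonneg h1.1 (Real.exp_pos (-(gaugeCoordSq L U / δg ^ 2))).le; linarith
    · calc F.indicator (fun _ => (1 : ℝ)) U * Real.exp (-(gaugeCoordSq L U / δg ^ 2)) ≤ 1 * 1 := mul_le_mul h1.2 h2 (Real.exp_pos _).le zero_le_one
        _ = 1 := one_mul 1
  have hNm : Measurable fun v : Edge 3 L → Fin 3 → ℝ => gaugeAvg χ (orthoTube L u v) := (measurable_gaugeAvg hχm).comp (measurable_orthoTube_right u)
  have hNb : ∀ v : Edge 3 L → Fin 3 → ℝ, |gaugeAvg χ (orthoTube L u v)| ≤ 1 := fun v => abs_gaugeAvg_le hχm hχb _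
  -- integrability
  have hiH : Integrable (fun v => h v * gaugeAvg χ (orthoTube L u v)) (orthoTransverse L) :=
    integrable_of_measurable_abs_le _ (hhm.mul hNm) (C := CΩ ^ 2 * Real.exp (R ^ 2 / δg ^ 2) * 1) fun v => by
      rw [abs_mul, abs_of_nonneg (hh0 v)]; exact mul_le_mul (hhb v) (hNb v) (abs_nonneg _) (by positivity)
  have hih : Integrable h (orthoTransverse L) := integrable_of_measurable_abs_le _ hhm (C := CΩ ^ 2 * Real.exp (R ^ 2 / δg ^ 2)) fun v => by
    rw [abs_of_nonneg (hh0 v)]; exact hhb v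
  -- rewrite the fibre mass
  have hfm : fibreMass L (softWeight χ) Ω u = ∫ v, h v * gaugeAvg χ (orthoTube L u v) ∂orthoTransverse L := by
    unfold fibreMass; exact integral_congr_ae (hae.mono fun v hv => hpt v hv)
  have hγ : boGamma L Ω δg Nbar = Nbar * ∫ v, h v ∂orthoTransverse L := rfl
  have hI0 : 0 ≤ ∫ v, h v ∂orthoTransverse L := integral_nonneg hh0
  -- two-sided bounds (a.e. on the cap)
  have hup : ∫ v, h v * gaugeAvg χ (orthoTube L u v) ∂orthoTransverse L ≤ ∫ v, h v * (Nbar * (1 + κ)) ∂orthoTransverse L := by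
    refine integral_mono_ae hiH (hih.mul_const _) (hae.mono fun v hv => ?_)
    by_cases hΩ0 : Ω (linkEmbed L v) = 0
    · have : h v = 0 := by simp only [hh, hΩ0]; ring
      simp only [this, zero_mul, le_refl]
    · exact mul_le_mul_of_nonneg_left (hN _ (hu v hv hΩ0)).2 (hh0 v)
  have hlo : ∫ v, h v * (Nbar * (1 - κ)) ∂orthoTransverse L ≤ ∫ v, h v * gaugeAvg χ (orthoTube L u v) ∂orthoTransverse L := by
    refine integral_mono_ae (hih.mul_const _) hiH (hae.mono fun v hv => ?_)
    by_cases hΩ0 : Ω (linkEmbed L v) = 0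
    · have : h v = 0 := by simp only [hh, hΩ0]; ring
      simp only [this, zero_mul, le_refl]
    · exact mul_le_mul_of_nonneg_left (hN _ (hu v hv hΩ0)).1 (hh0 v)
  rw [integral_mul_const] at hup hlo
  rw [hfm, hγ, abs_le]
  constructor <;> nlinarith [hup, hlo, hI0]

/-! ## §3 ★★ The record weight -/

/-- ★★ **FIBRE-MASS BRICK for the record weight** `χ_β = recordWeightRho δ ρ δg β`: if the fibres over `u` through `supp Ω` lie in the fat tube `fatTubeRho δ ρ β` and (P) holds there
with relative error `κ`, then `|fibreMass (N_β/χ_β) Ω u − γ_β| ≤ κγ_β`, `γ_β = boGamma Ω (δg β) N̄_β`. [cite: Luscher1983, §3] -/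
theorem fibreMass_brick_record (δ ρ δg : ℝ → ℝ) (β : ℝ) {Nbar κ : ℝ}
    (hN : ∀ U ∈ fatTubeRho L δ ρ β, Nbar * (1 - κ) ≤ gaugeAvg (recordWeightRho L δ ρ δg β) U ∧ gaugeAvg (recordWeightRho L δ ρ δg β) U ≤ Nbar * (1 + κ))
    {Ω : LinkSpace L → ℝ} (hΩ : Measurable Ω) {CΩ : ℝ} (hCΩ : ∀ x, |Ω x| ≤ CΩ) {R : ℝ} (hΩR : ∀ x, Ω x ≠ 0 → ‖x‖ ≤ R)
    {u : GaugeConfig 3 1 SU2} (hu : ∀ v ∈ capBalancedSet L, Ω (linkEmbed L v) ≠ 0 → orthoTube L u v ∈ fatTubeRho L δ ρ β) :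
    |fibreMass L (softWeight (recordWeightRho L δ ρ δg β)) Ω u - boGamma L Ω (δg β) Nbar| ≤ κ * boGamma L Ω (δg β) Nbar :=
  fibreMass_brick (F := fatTubeRho L δ ρ β) (fun _ => rfl) (measurable_recordWeightRho L δ ρ δg β) hN hΩ hCΩ hΩR hu

end Summit.QuantumFields.YangMills.Theorems.FemtoTransferGap.TwoLattice.ConstTube

end
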